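import Mathlib
import HarnessLib
import Summits.AtomisticToContinuum.FouriersLaw.Theses.JunctionLocality
import Summits.AtomisticToContinuum.FouriersLaw.Theorems.JunctionLocalitySuperadditiveResistanceKuboCutoff

/-!
# Kubo–Onsager for the γ-thermostatted pinned chain, II: finite Dirichlet energy of forward fields

Helper file (`--supports` stmt-AtomisticToContinuum-11748) for stub `stub_kuboOnsager` of the line
`floating-probe-bypass-laplacian` (crux `JunctionLocality.SuperadditiveResistance`). Setting: the pinned chain
`P = pinnedChain ω₂ lam β γ` (`ω₂ > 0`, `lam, β ≥ 0`), temperature `T > 0`, non-negative site weights `B`, a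
friction `c > 0`, and the equilibrium generator `L = X_H + c S_B` (`liouvilleOp + c·bathOp L B T`; the device of
the line is `B = deviceWeight`, `c = γ`, the plain chain is `B = bathWeight`). A FORWARD PAIR is `(g, k)` with
`g ∈ C²` and `σ X_H g + c S_B g = −k` pointwise (`σ = 1`: forward field of `k`; `σ = −1`: backward field).

* `integrable_mul_gibbsDensity_iff` — `F e^{-H/T} ∈ L¹(dx) ⟺ F ∈ L¹(μ_T)`; products/squares of `L²(μ_T)` functions.
* `dirichlet_level` — the carré-du-champ identity at cutoff level `n`:
  `c T Σ_i B_i ∫ χ_n (∂_{p_i} g)² ρ = ∫ χ_n g k ρ − c T Σ_i B_i ∫ g ∂_{p_i}χ_n ∂_{p_i} g ρ`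
  (exact; `X_H` drops out by `integral_chi_liouville_antisymm`, `S_B` by `integral_chi_mul_bathOp`).
* `integral_chi_partialP_sq_le` — for `g, k ∈ L²(μ_T)` a bound on `∫ χ_n (∂_{p_i} g)² ρ` UNIFORM in `n` at every
  site with `B_i > 0` (AM–GM on the cutoff-gradient term, `(∂χ_n)² ≤ (4K/(n+1)) χ_n`);
* `integrable_partialP_sq_mul_gibbsDensity`, `memLp_partialP` — hence (Fatou) `∂_{p_i} g ∈ L²(μ_T)`: forward
  fields have FINITE ENTROPY PRODUCTION. This is the integrability that all later limiting arguments need.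

References: Eckmann–Pillet–Rey-Bellet 1999 §3 (mechanism); folklore.
-/

noncomputable section

open MeasureTheory Filter Topology ProbabilityTheory
open scoped ContDiff NNReal ENNReal
open Literature.MathematicalPhysics.KineticTheory.HeatConduction
open Summit.AtomisticToContinuum.FouriersLaw.Theorems.SuperadditiveResistance.DeviceLiouville

namespace Summit.AtomisticToContinuum.FouriersLaw.Theorems.SuperadditiveResistance.Kubo

section Conversions

variable {ω₂ lam β : ℝ} {L : ℕ}

/-- `F e^{-H/T}` is Lebesgue integrable iff `F ∈ L¹(μ_T)` (pinned chain, `T > 0`). [folklore] -/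
theorem integrable_mul_gibbsDensity_iff (hω : 0 < ω₂) (hl : 0 ≤ lam) (hβ : 0 ≤ β) (γ : ℝ) (L : ℕ)
    {T : ℝ} (hT : 0 < T) (F : PhaseSpace L → ℝ) :
    Integrable (fun x => F x * (pinnedChain ω₂ lam β γ).gibbsDensity L T x) ↔
      Integrable F ((pinnedChain ω₂ lam β γ).gibbsMeasure L T) := by
  have hρint : Integrable ((pinnedChain ω₂ lam β γ).gibbsDensity L T) :=
    pinnedChain_integrable_gibbsDensity hω hl hβ γ L hT
  rw [OscillatorChain.gibbsMeasure_eq, integrable_tilted_iff hρint]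
  refine integrable_congr (ae_of_all _ fun x => ?_)
  simp only [smul_eq_mul, OscillatorChain.exp_neg_hamiltonian_div]
  ring

/-- A product of two `L²(μ_T)` functions is integrable against `e^{-H/T} dx`. [folklore] -/
theorem integrable_mul_mul_gibbsDensity (hω : 0 < ω₂) (hl : 0 ≤ lam) (hβ : 0 ≤ β) (γ : ℝ) (L : ℕ)
    {T : ℝ} (hT : 0 < T) {f g : PhaseSpace L → ℝ}
    (hf : MemLp f 2 ((pinnedChain ω₂ lam β γ).gibbsMeasure L T))
    (hg : MemLp g 2 ((pinnedChain ω₂ lam β γ).gibbsMeasure L T)) :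
    Integrable (fun x => f x * g x * (pinnedChain ω₂ lam β γ).gibbsDensity L T x) := by
  rw [integrable_mul_gibbsDensity_iff hω hl hβ γ L hT]
  exact hf.integrable_mul hg

/-- The square of an `L²(μ_T)` function is integrable against `e^{-H/T} dx`. [folklore] -/
theorem integrable_sq_mul_gibbsDensity (hω : 0 < ω₂) (hl : 0 ≤ lam) (hβ : 0 ≤ β) (γ : ℝ) (L : ℕ)
    {T : ℝ} (hT : 0 < T) {f : PhaseSpace L → ℝ}
    (hf : MemLp f 2 ((pinnedChain ω₂ lam β γ).gibbsMeasure L T)) :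
    Integrable (fun x => f x ^ 2 * (pinnedChain ω₂ lam β γ).gibbsDensity L T x) := by
  rw [integrable_mul_gibbsDensity_iff hω hl hβ γ L hT]
  exact hf.integrable_sq

/-- A continuous `F` with `F² e^{-H/T} ∈ L¹(dx)` is in `L²(μ_T)`. [folklore] -/
theorem memLp_of_integrable_sq_mul_gibbsDensity (hω : 0 < ω₂) (hl : 0 ≤ lam) (hβ : 0 ≤ β) (γ : ℝ)
    (L : ℕ) {T : ℝ} (hT : 0 < T) {F : PhaseSpace L → ℝ} (hFc : Continuous F)
    (hF : Integrable (fun x => F x ^ 2 * (pinnedChain ω₂ lam β γ).gibbsDensity L T x)) :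
    MemLp F 2 ((pinnedChain ω₂ lam β γ).gibbsMeasure L T) := by
  rw [memLp_two_iff_integrable_sq hFc.aestronglyMeasurable,
    ← integrable_mul_gibbsDensity_iff hω hl hβ γ L hT]
  exact hF

end Conversions

section Dirichlet

variable {ω₂ lam β : ℝ} {L : ℕ}

/-- AM–GM in the form used on the cutoff-gradient terms: `e² ≤ κ η` (`η, κ ≥ 0`) gives
`4 |e a w| ≤ η a² + 4 κ w²`. [folklore] -/
theorem four_mul_abs_le {η a e w κ : ℝ} (hη : 0 ≤ η) (hκ : 0 ≤ κ) (he : e ^ 2 ≤ κ * η) :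
    4 * |e * a * w| ≤ η * a ^ 2 + 4 * κ * w ^ 2 := by
  have h1 := amgm_aux zero_le_one hη hκ he (a := a) (w := w)
  have he' : (-e) ^ 2 ≤ κ * η := by simpa using he
  have h2 := amgm_aux zero_le_one hη hκ he' (a := a) (w := w)
  rcases le_or_gt 0 (e * a * w) with h | h
  · rw [abs_of_nonneg h]; nlinarith
  · rw [abs_of_neg h]; nlinarith

/-- **Carré du champ at cutoff level.** For a pair `(g, k)` (`g ∈ C²`, `σ X_H g + c S_B g = −k` pointwise, any `σ`)
of the pinned chain at `T > 0`:
`c T Σ_i B_i ∫ χ_n (∂_{p_i} g)² ρ = ∫ χ_n g k ρ − c T Σ_i B_i ∫ g ∂_{p_i}χ_n ∂_{p_i} g ρ`. [folklore] -/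
theorem dirichlet_level (hω : 0 < ω₂) (hl : 0 ≤ lam) (hβ : 0 ≤ β) (γ : ℝ) (L : ℕ) {T : ℝ} (hT : 0 < T)
    (B : Fin L → ℝ) (σ c : ℝ) {g k : PhaseSpace L → ℝ} (hg : ContDiff ℝ 2 g)
    (hpde : ∀ x, σ * liouvilleOp (pinnedChain ω₂ lam β γ) L g x + c * bathOp L B T g x = -k x) (n : ℕ) :
    c * T * ∑ i, B i * ∫ x, chi (pinnedChain ω₂ lam β γ) L n x * partialP i g x ^ 2 *
        (pinnedChain ω₂ lam β γ).gibbsDensity L T x =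
      (∫ x, chi (pinnedChain ω₂ lam β γ) L n x * g x * k x * (pinnedChain ω₂ lam β γ).gibbsDensity L T x) -
        c * T * ∑ i, B i * ∫ x, g x * partialP i (chi (pinnedChain ω₂ lam β γ) L n) x * partialP i g x *
          (pinnedChain ω₂ lam β γ).gibbsDensity L T x := by
  set P := pinnedChain ω₂ lam β γ with hP
  have hU := pinnedChain_contDiff_U ω₂ lam β γ (n := ∞)
  have hV := pinnedChain_contDiff_V ω₂ lam β γ (n := ∞)
  have hHs : ContDiff ℝ ∞ (P.hamiltonian L) := P.contDiff_hamiltonian hU hV L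
  have hH1 : ContDiff ℝ 1 (P.hamiltonian L) := hHs.of_le (by norm_cast)
  have hχs : ContDiff ℝ ∞ (chi P L n) := contDiff_chi hHs n
  have hχc : HasCompactSupport (chi P L n) := hasCompactSupport_chi hω hl hβ γ L n
  have hg1 : ContDiff ℝ 1 g := hg.of_le (by norm_cast)
  have hgC : Continuous g := hg.continuous
  have hρc : Continuous (P.gibbsDensity L T) := pinnedChain_continuous_gibbsDensity ω₂ lam β γ L T
  have hQc : ∀ i, Continuous (partialQ i g) := fun i => continuous_partialQ hg1 one_ne_zero i
  have hPc : ∀ i, Continuous (partialP i g) := fun i => continuous_partialP hg1 one_ne_zero i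
  have hPPc : ∀ i, Continuous (partialP i (partialP i g)) := fun i =>
    continuous_partialP (contDiff_partialP hg (by norm_num) i) one_ne_zero i
  have hWc : ∀ i, Continuous (partialQ i (P.hamiltonian L)) := fun i =>
    P.continuous_partialQ_hamiltonian hH1 i
  have hXc : Continuous (liouvilleOp P L g) := by
    unfold liouvilleOp; fun_prop
  have hSc : Continuous (bathOp L B T g) := by
    unfold bathOp; fun_prop
  -- antisymmetry of X_H and the OU Dirichlet form, both with f = g
  have hA := integral_chi_liouville_antisymm hω hl hβ γ L hT.ne' hg hg n
  have hA' : ∫ x, chi P L n x * g x * liouvilleOp P L g x * P.gibbsDensity L T x = 0 := by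
    have h2 : (fun x => chi P L n x * (g x * liouvilleOp P L g x + g x * liouvilleOp P L g x) *
        P.gibbsDensity L T x) = fun x => 2 * (chi P L n x * g x * liouvilleOp P L g x *
          P.gibbsDensity L T x) := by
      funext x; ring
    rw [h2, integral_const_mul] at hA
    linarith
  have hS := integral_chi_mul_bathOp hω hl hβ γ L B hT.ne' hg hg n
  -- integrate the pointwise equation against χ_n g ρ
  have hIX : Integrable fun x => chi P L n x * g x * liouvilleOp P L g x * P.gibbsDensity L T x :=
    Continuous.integrable_of_hasCompactSupport (by have := hχs.continuous; fun_prop)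
      (hχc.mul_right.mul_right.mul_right)
  have hIS : Integrable fun x => chi P L n x * g x * bathOp L B T g x * P.gibbsDensity L T x :=
    Continuous.integrable_of_hasCompactSupport (by have := hχs.continuous; fun_prop)
      (hχc.mul_right.mul_right.mul_right)
  have hpt : (fun x => chi P L n x * g x * k x * P.gibbsDensity L T x) = fun x =>
      -(σ * (chi P L n x * g x * liouvilleOp P L g x * P.gibbsDensity L T x) +
        c * (chi P L n x * g x * bathOp L B T g x * P.gibbsDensity L T x)) := by
    funext x
    have e := hpde x
    have : k x = -(σ * liouvilleOp P L g x + c * bathOp L B T g x) := by linarith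
    rw [this]; ring
  have hsq : ∀ i, (fun x => chi P L n x * partialP i g x * partialP i g x * P.gibbsDensity L T x) =
      fun x => chi P L n x * partialP i g x ^ 2 * P.gibbsDensity L T x := by
    intro i; funext x; ring
  simp +zetaDelta only [hsq] at hS
  rw [hpt, integral_neg, integral_add (hIX.const_mul σ) (hIS.const_mul c), integral_const_mul,
    integral_const_mul, hA', hS]
  simp only [mul_zero, zero_add, mul_add, Finset.sum_add_distrib]
  ring

/-- **Uniform bound on the cut-off Dirichlet energy.** For a forward pair `(g, k)` with `g, k ∈ L²(μ_T)`,
`B ≥ 0`, `c > 0` and a site `i` with `B_i > 0`, for every `n`: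
`∫ χ_n (∂_{p_i} g)² ρ ≤ (4/(3 c T B_i)) (∫ |g k| ρ + 4 c T K (Σ B) ∫ g² ρ)`. [folklore] -/
theorem integral_chi_partialP_sq_le (hω : 0 < ω₂) (hl : 0 ≤ lam) (hβ : 0 ≤ β) (γ : ℝ) (L : ℕ) {T : ℝ}
    (hT : 0 < T) (B : Fin L → ℝ) (hB : ∀ i, 0 ≤ B i) (σ : ℝ) {c : ℝ} (hc : 0 < c) {g k : PhaseSpace L → ℝ}
    (hg : ContDiff ℝ 2 g) (hg2 : MemLp g 2 ((pinnedChain ω₂ lam β γ).gibbsMeasure L T))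
    (hk2 : MemLp k 2 ((pinnedChain ω₂ lam β γ).gibbsMeasure L T))
    (hpde : ∀ x, σ * liouvilleOp (pinnedChain ω₂ lam β γ) L g x + c * bathOp L B T g x = -k x)
    {i : Fin L} (hi : 0 < B i) (n : ℕ) :
    ∫ x, chi (pinnedChain ω₂ lam β γ) L n x * partialP i g x ^ 2 * (pinnedChain ω₂ lam β γ).gibbsDensity L T x ≤
      4 / (3 * c * T * B i) * ((∫ x, |g x * k x| * (pinnedChain ω₂ lam β γ).gibbsDensity L T x) +
        4 * c * T * kuboConst * (∑ j, B j) *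
          ∫ x, g x ^ 2 * (pinnedChain ω₂ lam β γ).gibbsDensity L T x) := by
  set P := pinnedChain ω₂ lam β γ with hP
  obtain ⟨hφs, -, -, hφnn, -, hK, hdsq, -, -, -, hd2⟩ := kuboProfile_spec
  have hφd : Differentiable ℝ kuboProfile := hφs.differentiable (by simp)
  have hHs : ContDiff ℝ ∞ (P.hamiltonian L) :=
    P.contDiff_hamiltonian (pinnedChain_contDiff_U ω₂ lam β γ) (pinnedChain_contDiff_V ω₂ lam β γ) L
  have hχs : ContDiff ℝ ∞ (chi P L n) := contDiff_chi hHs n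
  have hχ1 : ContDiff ℝ 1 (chi P L n) := hχs.of_le (by norm_cast)
  have hχc : HasCompactSupport (chi P L n) := hasCompactSupport_chi hω hl hβ γ L n
  have hχd : Differentiable ℝ (chi P L n) := hχ1.differentiable one_ne_zero
  have hg1 : ContDiff ℝ 1 g := hg.of_le (by norm_cast)
  have hρc : Continuous (P.gibbsDensity L T) := pinnedChain_continuous_gibbsDensity ω₂ lam β γ L T
  have hρpos : ∀ x, 0 < P.gibbsDensity L T x := fun x => P.gibbsDensity_pos L T x
  have hPc : ∀ j, Continuous (partialP j g) := fun j => continuous_partialP hg1 one_ne_zero j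
  have hdχc : ∀ j, Continuous (partialP j (chi P L n)) := fun j => continuous_partialP hχ1 one_ne_zero j
  -- the cutoff gradient: (∂χ)² ≤ κ χ with κ = 4K/(n+1) ≤ 4K
  set κ : ℝ := 4 * kuboConst / ((n : ℝ) + 1) with hκ
  have hκ0 : 0 ≤ κ := by positivity
  have hκle : κ ≤ 4 * kuboConst := div_le_self (by positivity) (one_le_radius n)
  have hdχ_sq : ∀ j x, partialP j (chi P L n) x ^ 2 ≤ κ * chi P L n x := fun j x =>
    partialP_cutoff_sq_le hω.le hl hβ γ L hφd hK hφnn hdsq hd2 (one_le_radius n) j x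
  -- integrable pieces
  have hI_gk : Integrable fun x => g x * k x * P.gibbsDensity L T x :=
    integrable_mul_mul_gibbsDensity hω hl hβ γ L hT hg2 hk2
  have hI_g2 : Integrable fun x => g x ^ 2 * P.gibbsDensity L T x :=
    integrable_sq_mul_gibbsDensity hω hl hβ γ L hT hg2
  have hI_χd2 : ∀ j, Integrable fun x => chi P L n x * partialP j g x ^ 2 * P.gibbsDensity L T x := fun j =>
    Continuous.integrable_of_hasCompactSupport (by have := hχs.continuous; fun_prop)
      (hχc.mul_right.mul_right)
  have hI_err : ∀ j, Integrable fun x => g x * partialP j (chi P L n) x * partialP j g x *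
      P.gibbsDensity L T x := fun j =>
    Continuous.integrable_of_hasCompactSupport (by have := hg.continuous; fun_prop)
      (((hasCompactSupport_partialP hχd hχc j).mul_left).mul_right.mul_right)
  -- k is continuous (it is −(X_H g + c S_B g))
  have hH1 : ContDiff ℝ 1 (P.hamiltonian L) := hHs.of_le (by norm_cast)
  have hQc : ∀ j, Continuous (partialQ j g) := fun j => continuous_partialQ hg1 one_ne_zero j
  have hPPc : ∀ j, Continuous (partialP j (partialP j g)) := fun j =>
    continuous_partialP (contDiff_partialP hg (by norm_num) j) one_ne_zero j
  have hWc : ∀ j, Continuous (partialQ j (P.hamiltonian L)) := fun j =>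
    P.continuous_partialQ_hamiltonian hH1 j
  have hkc : Continuous k := by
    have hk : k = fun x => -(σ * liouvilleOp P L g x + c * bathOp L B T g x) := by
      funext x; have := hpde x; linarith
    rw [hk]
    unfold liouvilleOp bathOp
    fun_prop
  have hI_χgk : Integrable fun x => chi P L n x * g x * k x * P.gibbsDensity L T x :=
    Continuous.integrable_of_hasCompactSupport
      (by have := hχs.continuous; have := hg.continuous; fun_prop) (hχc.mul_right.mul_right.mul_right)
  -- the level identity
  have hlevel := dirichlet_level hω hl hβ γ L hT B σ c hg hpde n
  -- (1) the source term: ∫ χ g k ρ ≤ ∫ |g k| ρ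
  have h1 : ∫ x, chi P L n x * g x * k x * P.gibbsDensity L T x ≤
      ∫ x, |g x * k x| * P.gibbsDensity L T x := by
    refine integral_mono hI_χgk ?_ fun x => ?_
    · refine hI_gk.norm.congr (ae_of_all _ fun x => ?_)
      simp only [Real.norm_eq_abs, abs_mul, abs_of_pos (hρpos x)]
    · have hχ := abs_chi_le_one (P := P) n x
      have : chi P L n x * g x * k x ≤ |g x * k x| := by
        calc chi P L n x * g x * k x = chi P L n x * (g x * k x) := by ring
          _ ≤ |chi P L n x * (g x * k x)| := le_abs_self _
          _ = |chi P L n x| * |g x * k x| := abs_mul _ _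
          _ ≤ 1 * |g x * k x| := mul_le_mul_of_nonneg_right hχ (abs_nonneg _)
          _ = |g x * k x| := one_mul _
      exact mul_le_mul_of_nonneg_right this (hρpos x).le
  -- (2) the cutoff-gradient terms: −∫ g ∂χ ∂g ρ ≤ (1/4) ∫ χ (∂g)² ρ + κ ∫ g² ρ
  have h2 : ∀ j, -(∫ x, g x * partialP j (chi P L n) x * partialP j g x * P.gibbsDensity L T x) ≤
      (1 / 4) * (∫ x, chi P L n x * partialP j g x ^ 2 * P.gibbsDensity L T x) +
        κ * ∫ x, g x ^ 2 * P.gibbsDensity L T x := by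
    intro j
    rw [← integral_neg, ← integral_const_mul, ← integral_const_mul, ← integral_add
      ((hI_χd2 j).const_mul _) (hI_g2.const_mul _)]
    refine integral_mono (hI_err j).neg (((hI_χd2 j).const_mul _).add (hI_g2.const_mul _)) fun x => ?_
    have key := four_mul_abs_le (chi_nonneg (P := P) n x) hκ0 (hdχ_sq j x) (a := partialP j g x) (w := g x)
    have habs : -(g x * partialP j (chi P L n) x * partialP j g x) ≤
        |partialP j (chi P L n) x * partialP j g x * g x| := by
      rw [show g x * partialP j (chi P L n) x * partialP j g x =
        partialP j (chi P L n) x * partialP j g x * g x by ring]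
      exact neg_le_abs _
    have hρ := (hρpos x).le
    nlinarith [mul_le_mul_of_nonneg_right habs hρ, mul_le_mul_of_nonneg_right key hρ,
      mul_nonneg (chi_nonneg (P := P) n x) (sq_nonneg (partialP j g x))]
  -- (3) combine
  set D : Fin L → ℝ := fun j => ∫ x, chi P L n x * partialP j g x ^ 2 * P.gibbsDensity L T x with hD
  set E : Fin L → ℝ := fun j => ∫ x, g x * partialP j (chi P L n) x * partialP j g x *
    P.gibbsDensity L T x with hE
  set A : ℝ := ∫ x, |g x * k x| * P.gibbsDensity L T x with hA
  set G : ℝ := ∫ x, g x ^ 2 * P.gibbsDensity L T x with hG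
  have hD0 : ∀ j, 0 ≤ D j := fun j => integral_nonneg fun x =>
    mul_nonneg (mul_nonneg (chi_nonneg (P := P) n x) (sq_nonneg _)) (hρpos x).le
  have hG0 : 0 ≤ G := integral_nonneg fun x => mul_nonneg (sq_nonneg _) (hρpos x).le
  have hsumB : 0 ≤ ∑ j, B j := Finset.sum_nonneg fun j _ => hB j
  have hlevel' : c * T * ∑ j, B j * D j = (∫ x, chi P L n x * g x * k x * P.gibbsDensity L T x) -
      c * T * ∑ j, B j * E j := hlevel
  have h2' : ∀ j, -(B j * E j) ≤ B j * ((1 / 4) * D j + κ * G) := by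
    intro j
    have := mul_le_mul_of_nonneg_left (h2 j) (hB j)
    linarith
  have hsum2 : -(∑ j, B j * E j) ≤ ∑ j, B j * ((1 / 4) * D j + κ * G) := by
    rw [← Finset.sum_neg_distrib]
    exact Finset.sum_le_sum fun j _ => h2' j
  have hsplit : ∑ j, B j * ((1 / 4) * D j + κ * G) = (1 / 4) * ∑ j, B j * D j + κ * G * ∑ j, B j := by
    rw [Finset.mul_sum, Finset.mul_sum, ← Finset.sum_add_distrib]
    refine Finset.sum_congr rfl fun j _ => ?_
    ring
  have hcT : 0 < c * T := mul_pos hc hT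
  have hmain : 3 / 4 * (c * T) * ∑ j, B j * D j ≤ A + c * T * (4 * kuboConst) * (∑ j, B j) * G := by
    have e1 : c * T * ∑ j, B j * D j ≤ A + c * T * ((1 / 4) * ∑ j, B j * D j + κ * G * ∑ j, B j) := by
      have := mul_le_mul_of_nonneg_left hsum2 hcT.le
      rw [hsplit] at this
      linarith
    have e2 : c * T * (κ * G * ∑ j, B j) ≤ c * T * (4 * kuboConst) * (∑ j, B j) * G := by
      have := mul_le_mul_of_nonneg_right hκle (mul_nonneg hG0 hsumB)
      nlinarith [hcT.le]
    nlinarith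
  have hsingle : B i * D i ≤ ∑ j, B j * D j :=
    Finset.single_le_sum (f := fun j => B j * D j) (fun j _ => mul_nonneg (hB j) (hD0 j)) (Finset.mem_univ i)
  have hden : 0 < 3 * c * T * B i := by positivity
  have hBD : c * T * (B i * D i) ≤ c * T * ∑ j, B j * D j := mul_le_mul_of_nonneg_left hsingle hcT.le
  have hgoal : D i * (3 * c * T * B i) ≤ 4 * (A + 4 * c * T * kuboConst * (∑ j, B j) * G) := by
    nlinarith [hmain, hBD]
  calc D i = D i * (3 * c * T * B i) / (3 * c * T * B i) := by field_simp
    _ ≤ 4 * (A + 4 * c * T * kuboConst * (∑ j, B j) * G) / (3 * c * T * B i) :=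
        div_le_div_of_nonneg_right hgoal hden.le
    _ = 4 / (3 * c * T * B i) * (A + 4 * c * T * kuboConst * (∑ j, B j) * G) := by ring

/-- **Forward fields have finite entropy production.** For a forward pair `(g, k)` with `g, k ∈ L²(μ_T)`, `B ≥ 0`,
`c > 0`: `(∂_{p_i} g)² e^{-H/T} ∈ L¹(dx)` at every site with `B_i > 0` (Fatou on the uniform bound
`integral_chi_partialP_sq_le`, the cut-off integrands being eventually equal to the limit pointwise). [folklore] -/
theorem integrable_partialP_sq_mul_gibbsDensity (hω : 0 < ω₂) (hl : 0 ≤ lam) (hβ : 0 ≤ β) (γ : ℝ) (L : ℕ)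
    {T : ℝ} (hT : 0 < T) (B : Fin L → ℝ) (hB : ∀ i, 0 ≤ B i) (σ : ℝ) {c : ℝ} (hc : 0 < c) {g k : PhaseSpace L → ℝ}
    (hg : ContDiff ℝ 2 g) (hg2 : MemLp g 2 ((pinnedChain ω₂ lam β γ).gibbsMeasure L T))
    (hk2 : MemLp k 2 ((pinnedChain ω₂ lam β γ).gibbsMeasure L T))
    (hpde : ∀ x, σ * liouvilleOp (pinnedChain ω₂ lam β γ) L g x + c * bathOp L B T g x = -k x)
    {i : Fin L} (hi : 0 < B i) :
    Integrable fun x => partialP i g x ^ 2 * (pinnedChain ω₂ lam β γ).gibbsDensity L T x := by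
  set P := pinnedChain ω₂ lam β γ with hP
  set M : ℝ := 4 / (3 * c * T * B i) * ((∫ x, |g x * k x| * P.gibbsDensity L T x) +
    4 * c * T * kuboConst * (∑ j, B j) * ∫ x, g x ^ 2 * P.gibbsDensity L T x) with hM
  have hbound : ∀ n, ∫ x, chi P L n x * partialP i g x ^ 2 * P.gibbsDensity L T x ≤ M := fun n =>
    integral_chi_partialP_sq_le hω hl hβ γ L hT B hB σ hc hg hg2 hk2 hpde hi n
  have hHs : ContDiff ℝ ∞ (P.hamiltonian L) :=
    P.contDiff_hamiltonian (pinnedChain_contDiff_U ω₂ lam β γ) (pinnedChain_contDiff_V ω₂ lam β γ) L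
  have hg1 : ContDiff ℝ 1 g := hg.of_le (by norm_cast)
  have hρc : Continuous (P.gibbsDensity L T) := pinnedChain_continuous_gibbsDensity ω₂ lam β γ L T
  have hρpos : ∀ x, 0 < P.gibbsDensity L T x := fun x => P.gibbsDensity_pos L T x
  have hPc : Continuous (partialP i g) := continuous_partialP hg1 one_ne_zero i
  have hχcont : ∀ n, Continuous (chi P L n) := fun n => (contDiff_chi hHs n).continuous
  have hχc : ∀ n, HasCompactSupport (chi P L n) := fun n => hasCompactSupport_chi hω hl hβ γ L n
  -- the limit integrand and the cut-off integrands, as ℝ≥0∞-valued functions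
  set F : PhaseSpace L → ℝ := fun x => partialP i g x ^ 2 * P.gibbsDensity L T x with hF
  set f : ℕ → PhaseSpace L → ℝ≥0∞ := fun n x => ENNReal.ofReal (chi P L n x * F x) with hf
  have hF0 : ∀ x, 0 ≤ F x := fun x => mul_nonneg (sq_nonneg _) (hρpos x).le
  have hFc : Continuous F := by simp only [hF]; fun_prop
  have hfm : ∀ n, Measurable (f n) := fun n =>
    ((hχcont n).mul hFc).measurable.ennreal_ofReal
  have hI : ∀ n, Integrable fun x => chi P L n x * F x := fun n =>
    Continuous.integrable_of_hasCompactSupport ((hχcont n).mul hFc) ((hχc n).mul_right)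
  -- ∫⁻ f_n ≤ M
  have hlin : ∀ n, ∫⁻ x, f n x = ENNReal.ofReal (∫ x, chi P L n x * F x) := fun n =>
    (ofReal_integral_eq_lintegral_ofReal (hI n)
      (ae_of_all _ fun x => mul_nonneg (chi_nonneg (P := P) n x) (hF0 x))).symm
  have hle : ∀ n, ∫⁻ x, f n x ≤ ENNReal.ofReal M := by
    intro n
    rw [hlin n]
    refine ENNReal.ofReal_le_ofReal ?_
    have : (fun x => chi P L n x * F x) = fun x => chi P L n x * partialP i g x ^ 2 * P.gibbsDensity L T x := by
      funext x; simp only [hF]; ring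
    rw [this]
    exact hbound n
  -- pointwise: f_n x → ofReal (F x) (eventually equal)
  have hptw : ∀ x, liminf (fun n => f n x) atTop = ENNReal.ofReal (F x) := by
    intro x
    refine Filter.Tendsto.liminf_eq ?_
    refine tendsto_const_nhds.congr' ?_
    filter_upwards [eventually_chi_eq_one (P := P) (pinnedChain_hamiltonian_nonneg hω.le hl hβ γ L x)]
      with n hn
    simp only [hf, hn, one_mul]
  -- Fatou
  have hfatou : ∫⁻ x, ENNReal.ofReal (F x) ≤ ENNReal.ofReal M := by
    calc ∫⁻ x, ENNReal.ofReal (F x) = ∫⁻ x, liminf (fun n => f n x) atTop :=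
          lintegral_congr fun x => (hptw x).symm
      _ ≤ liminf (fun n => ∫⁻ x, f n x) atTop := lintegral_liminf_le hfm
      _ ≤ ENNReal.ofReal M := Filter.liminf_le_of_frequently_le' (Filter.Eventually.of_forall hle).frequently
  refine ⟨hFc.aestronglyMeasurable, ?_⟩
  rw [hasFiniteIntegral_iff_ofReal (ae_of_all _ hF0)]
  exact lt_of_le_of_lt hfatou ENNReal.ofReal_lt_top

/-- Hence `∂_{p_i} g ∈ L²(μ_T)` at every site with `B_i > 0`. [folklore] -/
theorem memLp_partialP (hω : 0 < ω₂) (hl : 0 ≤ lam) (hβ : 0 ≤ β) (γ : ℝ) (L : ℕ) {T : ℝ} (hT : 0 < T)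
    (B : Fin L → ℝ) (hB : ∀ i, 0 ≤ B i) (σ : ℝ) {c : ℝ} (hc : 0 < c) {g k : PhaseSpace L → ℝ}
    (hg : ContDiff ℝ 2 g) (hg2 : MemLp g 2 ((pinnedChain ω₂ lam β γ).gibbsMeasure L T))
    (hk2 : MemLp k 2 ((pinnedChain ω₂ lam β γ).gibbsMeasure L T))
    (hpde : ∀ x, σ * liouvilleOp (pinnedChain ω₂ lam β γ) L g x + c * bathOp L B T g x = -k x)
    {i : Fin L} (hi : 0 < B i) :
    MemLp (partialP i g) 2 ((pinnedChain ω₂ lam β γ).gibbsMeasure L T) :=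
  memLp_of_integrable_sq_mul_gibbsDensity hω hl hβ γ L hT
    (continuous_partialP (hg.of_le (by norm_cast) : ContDiff ℝ 1 g) one_ne_zero i)
    (integrable_partialP_sq_mul_gibbsDensity hω hl hβ γ L hT B hB σ hc hg hg2 hk2 hpde hi)

end Dirichlet

/-- Registered helper sub-goal `helper_kuboMemLpPartialP` of stub `stub_kuboOnsager` (= `memLp_partialP` in stub form; line
`floating-probe-bypass-laplacian`, crux stmt-AtomisticToContinuum-11748). [folklore] -/
theorem helper_kuboMemLpPartialP : ∀ {ω₂ lam β : ℝ}, 0 < ω₂ → 0 ≤ lam → 0 ≤ β → ∀ (γ : ℝ) (L : ℕ) {T : ℝ}, 0 < T → ∀ (B : Fin L → ℝ), (∀ i, 0 ≤ B i) → ∀ (σ : ℝ) {c : ℝ}, 0 < c → ∀ {g k : PhaseSpace L → ℝ}, ContDiff ℝ 2 g → MemLp g 2 ((pinnedChain ω₂ lam β γ).gibbsMeasure L T) → MemLp k 2 ((pinnedChain ω₂ lam β γ).gibbsMeasure L T) → (∀ x, σ * liouvilleOp (pinnedChain ω₂ lam β γ) L g x + c * bathOp L B T g x = -k x) → ∀ {i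 : Fin L}, 0 < B i → MemLp (partialP i g) 2 ((pinnedChain ω₂ lam β γ).gibbsMeasure L T) :=
  @memLp_partialP

end Summit.AtomisticToContinuum.FouriersLaw.Theorems.SuperadditiveResistance.Kubo

end
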